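import Mathlib.Analysis.SpecialFunctions.Log.Deriv
import Mathlib.Analysis.SpecificLimits.Basic
import Mathlib.Algebra.BigOperators.Field
import HarnessLib

/-!
# Kernel-evaluable enclosures of `log ((q + p)/(q − p))` to arbitrary precision

Topic `Literature/Analysis/SpecialFunctions`, namespace
`Literature.Analysis.SpecialFunctions.KernelLogRatio`. Everything here is PROVED; the only `def`s
are seven computable (kernel-evaluable) functions on `ℕ`.

For natural numbers `p < q` and `x = p/q ∈ [0, 1)` Mathlib has the series
`log (1 + x) − log (1 − x) = ∑_{k ≥ 0} 2 x^{2k+1}/(2k + 1)` (`Real.hasSum_log_sub_log_of_abs_lt_one`),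
i.e. `log ((q + p)/(q − p)) = 2 artanh (p/q)`. With a binary scale `2^S` and `M = B · C` terms put

* `atanhTerm p q S k = ⌊2^S p^{2k+1} / ((2k + 1) q^{2k+1})⌋` (floor division in `ℕ`) and
  `atanhFloorSum p q S M = ∑_{k < M} atanhTerm p q S k`, evaluated as a two-level sum
  `atanhFloorSum₂ p q S C B` (blocks of `C` terms, so that the kernel's evaluation depth is `B + C`
  rather than `M`; `atanhFloorSum₂_eq`);
* `tailCeil p q S M = ⌈2^{S+1} p^{2M+1} q² / ((2M + 1) q^{2M+1} (q² − p²))⌉`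
  (the scaled geometric bound `2 x^{2M+1}/((2M + 1)(1 − x²))` for the tail `∑_{k ≥ M}`);
* `logRatioLo p q S B C = 2 · atanhFloorSum₂ p q S C B`,
  `logRatioHi p q S B C = 2 · (atanhFloorSum₂ p q S C B + BC) + tailCeil p q S (BC)`;

then (`log_ratio_mem`)

  `logRatioLo p q S B C / 2^S ≤ log ((q + p)/(q − p)) ≤ logRatioHi p q S B C / 2^S`,

an enclosure of width `≤ (2BC + tailCeil + 2)/2^S`, i.e. as sharp as one likes for
`BC ≍ S / (2 log₂(q/p))` terms. All functions are evaluated by the kernel (`decide +kernel`;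
`Nat.pow`, `Nat.div` on literals are GMP-backed), so that a consumer states an enclosure with
explicit numerals and proves it by one kernel evaluation — see `log_two_mem` below
(`log 2 = log ((3 + 1)/(3 − 1))`, `1080` terms, scale `2^3400`, width `< 2⁻³³⁸⁸ < 10⁻¹⁰²⁰`) and
`QuadraticFields/BakerTwoLogNumerics.lean` (1000-digit enclosures of `log ε₂₁`, `log ε₃₃` for
the medium range of Baker's class number one argument). Compared with the tree's `KernelLog.lean`
(`logIv`: `log n` to `≈ 13` digits at scale `2⁸⁰`, tuned for `10⁶` evaluations) this file trades
speed for unbounded precision (one evaluation to `10³` digits in seconds of kernel time).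

## References

* Mathlib, `Mathlib/Analysis/SpecialFunctions/Log/Deriv.lean`
  (`Real.hasSum_log_sub_log_of_abs_lt_one`), `Mathlib/Analysis/SpecificLimits/Basic.lean`
  (`hasSum_geometric_of_lt_one`).
-/

namespace Literature.Analysis.SpecialFunctions.KernelLogRatio

open Finset

/-! ### The kernel-evaluable functions -/

/-- `⌊2^S p^{2k+1} / ((2k+1) q^{2k+1})⌋`. [folklore] -/
def atanhTerm (p q S k : ℕ) : ℕ := 2 ^ S * p ^ (2 * k + 1) / ((2 * k + 1) * q ^ (2 * k + 1))

/-- `∑_{k < M} atanhTerm p q S k`, by structural recursion on `M` (the specification; evaluate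
`atanhFloorSum₂` instead). [folklore] -/
def atanhFloorSum (p q S : ℕ) : ℕ → ℕ
  | 0 => 0
  | k + 1 => atanhTerm p q S k + atanhFloorSum p q S k

/-- The block `∑_{j < C} atanhTerm p q S (k₀ + j)`. [folklore] -/
def atanhBlock (p q S k₀ : ℕ) : ℕ → ℕ
  | 0 => 0
  | j + 1 => atanhTerm p q S (k₀ + j) + atanhBlock p q S k₀ j

/-- Two-level evaluation `∑_{i < B} atanhBlock p q S (iC) C = atanhFloorSum p q S (BC)`
(`atanhFloorSum₂_eq`). [folklore] -/
def atanhFloorSum₂ (p q S C : ℕ) : ℕ → ℕ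
  | 0 => 0
  | i + 1 => atanhBlock p q S (i * C) C + atanhFloorSum₂ p q S C i

/-- `⌈2^{S+1} p^{2M+1} q² / ((2M+1) q^{2M+1} (q² − p²))⌉`, the scaled tail bound. [folklore] -/
def tailCeil (p q S M : ℕ) : ℕ :=
  (2 ^ (S + 1) * p ^ (2 * M + 1) * q ^ 2 + ((2 * M + 1) * q ^ (2 * M + 1) * (q ^ 2 - p ^ 2) - 1)) /
    ((2 * M + 1) * q ^ (2 * M + 1) * (q ^ 2 - p ^ 2))

/-- Scaled lower bound for `log ((q+p)/(q−p))` (`B` blocks of `C` terms). [folklore] -/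
def logRatioLo (p q S B C : ℕ) : ℕ := 2 * atanhFloorSum₂ p q S C B

/-- Scaled upper bound for `log ((q+p)/(q−p))` (`B` blocks of `C` terms). [folklore] -/
def logRatioHi (p q S B C : ℕ) : ℕ := 2 * (atanhFloorSum₂ p q S C B + B * C) + tailCeil p q S (B * C)

/-! ### The two-level sum is the sum -/

/-- `∑_{k < k₀ + j} = (block of j terms from k₀) + ∑_{k < k₀}`. [folklore] -/
theorem atanhFloorSum_add (p q S k₀ : ℕ) : ∀ j : ℕ,
    atanhFloorSum p q S (k₀ + j) = atanhBlock p q S k₀ j + atanhFloorSum p q S k₀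
  | 0 => by simp [atanhBlock]
  | j + 1 => by
    rw [← Nat.add_assoc, atanhFloorSum, atanhBlock, atanhFloorSum_add p q S k₀ j, Nat.add_assoc]

/-- **`atanhFloorSum₂ p q S C B = atanhFloorSum p q S (B · C)`.** [folklore] -/
theorem atanhFloorSum₂_eq (p q S C : ℕ) : ∀ B : ℕ,
    atanhFloorSum₂ p q S C B = atanhFloorSum p q S (B * C)
  | 0 => by simp [atanhFloorSum₂, atanhFloorSum]
  | B + 1 => by
    rw [atanhFloorSum₂, atanhFloorSum₂_eq p q S C B, Nat.succ_mul, atanhFloorSum_add]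

/-! ### Floor and ceiling division in `ℕ`, read in `ℝ` -/

/-- `⌊n/d⌋ ≤ n/d < ⌊n/d⌋ + 1`. [folklore] -/
theorem floorDiv_mem {n d : ℕ} (hd : 0 < d) :
    ((n / d : ℕ) : ℝ) ≤ (n : ℝ) / d ∧ (n : ℝ) / d < (n / d : ℕ) + 1 := by
  have hd' : (0 : ℝ) < d := by exact_mod_cast hd
  have h1 : d * (n / d) + n % d = n := Nat.div_add_mod n d
  have h2 : n % d < d := Nat.mod_lt n hd
  have h1' : ((d : ℝ)) * ((n / d : ℕ) : ℝ) + ((n % d : ℕ) : ℝ) = n := by exact_mod_cast h1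
  have h2' : ((n % d : ℕ) : ℝ) < d := by exact_mod_cast h2
  have h3 : (0 : ℝ) ≤ ((n % d : ℕ) : ℝ) := Nat.cast_nonneg _
  constructor
  · rw [le_div_iff₀ hd']; nlinarith
  · rw [div_lt_iff₀ hd']; nlinarith

/-- `a ≤ ⌈a/d⌉ · d` for the ceiling division `(a + (d − 1))/d`. [folklore] -/
theorem le_ceilDiv_mul {a d : ℕ} (hd : 0 < d) : a ≤ (a + (d - 1)) / d * d := by
  have h1 := Nat.div_add_mod (a + (d - 1)) d
  have h2 : (a + (d - 1)) % d < d := Nat.mod_lt _ hd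
  have h3 : d * ((a + (d - 1)) / d) ≥ a := by omega
  rw [Nat.mul_comm]
  exact h3

/-! ### The exact scaled partial sums -/

/-- The floor sums enclose the exact scaled partial sum
`∑_{k<M} 2^S p^{2k+1}/((2k+1) q^{2k+1})` to within `M`. [folklore] -/
theorem atanhFloorSum_mem (p q S : ℕ) (hq : 0 < q) : ∀ M : ℕ,
    (atanhFloorSum p q S M : ℝ) ≤
        ∑ k ∈ range M, ((2 ^ S * p ^ (2 * k + 1) : ℕ) : ℝ) / (((2 * k + 1) * q ^ (2 * k + 1) : ℕ) : ℝ) ∧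
      ∑ k ∈ range M, ((2 ^ S * p ^ (2 * k + 1) : ℕ) : ℝ) / (((2 * k + 1) * q ^ (2 * k + 1) : ℕ) : ℝ) ≤
        (atanhFloorSum p q S M : ℝ) + M
  | 0 => by simp [atanhFloorSum]
  | M + 1 => by
    obtain ⟨ih1, ih2⟩ := atanhFloorSum_mem p q S hq M
    have hd : 0 < (2 * M + 1) * q ^ (2 * M + 1) := Nat.mul_pos (by omega) (Nat.pow_pos hq)
    obtain ⟨h1, h2⟩ := floorDiv_mem (n := 2 ^ S * p ^ (2 * M + 1)) hd
    rw [sum_range_succ, atanhFloorSum, atanhTerm]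
    simp only [Nat.cast_add, Nat.cast_one]
    constructor <;> linarith

/-! ### The enclosure -/

/-- **`log ((q + p)/(q − p))` is enclosed by `logRatioLo/2^S` and `logRatioHi/2^S`** (`p < q`): the
partial sums of Mathlib's series `log(1 + x) − log(1 − x) = ∑ 2x^{2k+1}/(2k+1)`, `x = p/q`, read
through the floor sums, and the tail bounded by the geometric series
`2x^{2M+1}/((2M+1)(1 − x²))`, `M = BC`. [folklore] -/
theorem log_ratio_mem {p q : ℕ} (hpq : p < q) (S B C : ℕ) :
    (logRatioLo p q S B C : ℝ) / 2 ^ S ≤ Real.log ((q + p : ℝ) / (q - p)) ∧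
      Real.log ((q + p : ℝ) / (q - p)) ≤ (logRatioHi p q S B C : ℝ) / 2 ^ S := by
  have hq : 0 < q := by omega
  have hqR : (0 : ℝ) < q := by exact_mod_cast hq
  have hq0 : (q : ℝ) ≠ 0 := hqR.ne'
  have hpR : (0 : ℝ) ≤ p := Nat.cast_nonneg p
  have hpqR : (p : ℝ) < q := by exact_mod_cast hpq
  set M : ℕ := B * C with hM
  set x : ℝ := (p : ℝ) / q with hx
  have hx0 : 0 ≤ x := div_nonneg hpR hqR.le
  have hx1 : x < 1 := (div_lt_one hqR).2 hpqR
  have habs : |x| < 1 := by rw [abs_of_nonneg hx0]; exact hx1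
  have hS : (0 : ℝ) < 2 ^ S := by positivity
  -- the value of the series
  have hT : Real.log (1 + x) - Real.log (1 - x) = Real.log ((q + p : ℝ) / (q - p)) := by
    have h1 : 1 + x = (q + p : ℝ) / q := by rw [hx]; field_simp
    have h2 : 1 - x = (q - p : ℝ) / q := by rw [hx]; field_simp
    rw [h1, h2, Real.log_div (by linarith) hq0, Real.log_div (by linarith) hq0,
      Real.log_div (by linarith) (by linarith)]
    ring
  set f : ℕ → ℝ := fun k => (2 : ℝ) * (1 / (2 * k + 1)) * x ^ (2 * k + 1) with hf
  have hsum : HasSum f (Real.log ((q + p : ℝ) / (q - p))) :=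
    hT ▸ Real.hasSum_log_sub_log_of_abs_lt_one habs
  have hf0 : ∀ k, 0 ≤ f k := fun k => by simp only [hf]; positivity
  -- partial sums versus the floor sums
  set E : ℕ → ℝ := fun N => ∑ k ∈ range N, ((2 ^ S * p ^ (2 * k + 1) : ℕ) : ℝ) /
      (((2 * k + 1) * q ^ (2 * k + 1) : ℕ) : ℝ) with hE
  have hpartial : ∀ N : ℕ, ∑ k ∈ range N, f k = 2 * E N / 2 ^ S := by
    intro N
    simp only [hE]
    rw [mul_sum, sum_div]
    refine sum_congr rfl fun k _ => ?_
    simp only [hf, hx]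
    have hk : (2 * (k : ℝ) + 1) ≠ 0 := by positivity
    have hqk : ((q : ℝ) ^ (2 * k + 1)) ≠ 0 := by positivity
    push_cast
    rw [div_pow]
    field_simp
  obtain ⟨hfl1, hfl2⟩ := atanhFloorSum_mem p q S hq M
  have hLo : (logRatioLo p q S B C : ℝ) = 2 * (atanhFloorSum p q S M : ℝ) := by
    simp [logRatioLo, atanhFloorSum₂_eq, hM]
  have hHi : (logRatioHi p q S B C : ℝ) =
      2 * ((atanhFloorSum p q S M : ℝ) + M) + (tailCeil p q S M : ℝ) := by
    simp [logRatioHi, atanhFloorSum₂_eq, hM]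
  constructor
  · -- lower bound: partial sum ≤ total
    have hle : ∑ k ∈ range M, f k ≤ Real.log ((q + p : ℝ) / (q - p)) :=
      sum_le_hasSum (range M) (fun k _ => hf0 k) hsum
    rw [hpartial M] at hle
    refine le_trans ?_ hle
    rw [div_le_div_iff_of_pos_right hS, hLo]
    linarith
  · -- upper bound: total = partial sum + tail, tail ≤ geometric bound ≤ tailCeil / 2^S
    have htail : HasSum (fun n => f (n + M))
        (Real.log ((q + p : ℝ) / (q - p)) - ∑ k ∈ range M, f k) :=
      (hasSum_nat_add_iff M).2 (by rwa [sub_add_cancel])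
    have hx2 : x ^ 2 < 1 := by nlinarith
    set K : ℝ := 2 / (2 * M + 1) * x ^ (2 * M + 1) with hK
    have hgeom : HasSum (fun n : ℕ => K * (x ^ 2) ^ n) (K * (1 - x ^ 2)⁻¹) :=
      (hasSum_geometric_of_lt_one (sq_nonneg x) hx2).mul_left K
    have hcmp : ∀ n : ℕ, f (n + M) ≤ K * (x ^ 2) ^ n := by
      intro n
      simp only [hf, hK]
      have h1 : (2 : ℝ) * (1 / (2 * ((n + M : ℕ) : ℝ) + 1)) ≤ 2 / (2 * M + 1) := by
        rw [mul_one_div]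
        apply div_le_div_of_nonneg_left (by norm_num) (by positivity)
        push_cast; linarith
      have h2 : x ^ (2 * (n + M) + 1) = x ^ (2 * M + 1) * (x ^ 2) ^ n := by
        rw [← pow_mul, ← pow_add]
        congr 1
        ring
      rw [h2, ← mul_assoc]
      apply mul_le_mul_of_nonneg_right _ (by positivity)
      exact mul_le_mul_of_nonneg_right h1 (by positivity)
    have htail_le : Real.log ((q + p : ℝ) / (q - p)) - ∑ k ∈ range M, f k ≤ K * (1 - x ^ 2)⁻¹ :=
      hasSum_le hcmp htail hgeom
    -- the geometric bound versus `tailCeil`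
    have hp2 : p ^ 2 ≤ q ^ 2 := Nat.pow_le_pow_left hpq.le 2
    have hp2' : p ^ 2 < q ^ 2 := Nat.pow_lt_pow_left hpq two_ne_zero
    have hden : 0 < (2 * M + 1) * q ^ (2 * M + 1) * (q ^ 2 - p ^ 2) :=
      Nat.mul_pos (Nat.mul_pos (by omega) (Nat.pow_pos hq)) (by omega)
    have hceil := le_ceilDiv_mul (a := 2 ^ (S + 1) * p ^ (2 * M + 1) * q ^ 2) hden
    have hceil' : ((2 ^ (S + 1) * p ^ (2 * M + 1) * q ^ 2 : ℕ) : ℝ) ≤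
        (tailCeil p q S M : ℝ) * (((2 * M + 1) * q ^ (2 * M + 1) * (q ^ 2 - p ^ 2) : ℕ) : ℝ) := by
      rw [tailCeil]; exact_mod_cast hceil
    have hdenR : (((2 * M + 1) * q ^ (2 * M + 1) * (q ^ 2 - p ^ 2) : ℕ) : ℝ) =
        (2 * M + 1) * (q : ℝ) ^ (2 * M + 1) * ((q : ℝ) ^ 2 - (p : ℝ) ^ 2) := by
      push_cast [Nat.cast_sub hp2]; ring
    have hnumR : ((2 ^ (S + 1) * p ^ (2 * M + 1) * q ^ 2 : ℕ) : ℝ) =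
        2 ^ (S + 1) * (p : ℝ) ^ (2 * M + 1) * (q : ℝ) ^ 2 := by push_cast; ring
    have hq2p2 : (0 : ℝ) < (q : ℝ) ^ 2 - (p : ℝ) ^ 2 := by nlinarith
    have hpos : (0 : ℝ) < (2 * M + 1) * (q : ℝ) ^ (2 * M + 1) * ((q : ℝ) ^ 2 - (p : ℝ) ^ 2) := by
      positivity
    -- `K (1 - x²)⁻¹ · 2^S · den = num` as real numbers
    have hx2q : 1 - x ^ 2 = ((q : ℝ) ^ 2 - (p : ℝ) ^ 2) / (q : ℝ) ^ 2 := by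
      rw [hx]; field_simp
    have hKden : K * (1 - x ^ 2)⁻¹ * 2 ^ S * ((2 * M + 1) * (q : ℝ) ^ (2 * M + 1) *
        ((q : ℝ) ^ 2 - (p : ℝ) ^ 2)) = 2 ^ (S + 1) * (p : ℝ) ^ (2 * M + 1) * (q : ℝ) ^ 2 := by
      rw [hx2q, hK, hx, div_pow, inv_div]
      have hM0 : (2 * (M : ℝ) + 1) ≠ 0 := by positivity
      field_simp
      ring
    have hKle : K * (1 - x ^ 2)⁻¹ ≤ (tailCeil p q S M : ℝ) / 2 ^ S := by
      rw [le_div_iff₀ hS]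
      refine le_of_mul_le_mul_right ?_ hpos
      rw [hKden, ← hnumR]
      refine hceil'.trans_eq ?_
      rw [hdenR]
    -- assemble
    have htot : Real.log ((q + p : ℝ) / (q - p)) ≤
        ∑ k ∈ range M, f k + (tailCeil p q S M : ℝ) / 2 ^ S := by linarith
    rw [hpartial M, ← add_div] at htot
    refine htot.trans ?_
    rw [div_le_div_iff_of_pos_right hS, hHi]
    linarith

/-! ### Example and first consumer: `log 2` to `1020` digits -/

/-- **`log 2` enclosed to width `< 2⁻³³⁸⁸ < 10⁻¹⁰²⁰`**: `log 2 = log ((3 + 1)/(3 − 1))` with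
`1080 = 36 · 30` terms at scale `2^3400`. [folklore] -/
theorem log_two_mem :
    (logRatioLo 1 3 3400 36 30 : ℝ) / 2 ^ 3400 ≤ Real.log 2 ∧
      Real.log 2 ≤ (logRatioHi 1 3 3400 36 30 : ℝ) / 2 ^ 3400 := by
  have h := log_ratio_mem (p := 1) (q := 3) (by norm_num) 3400 36 30
  have e : (((3 : ℕ) : ℝ) + ((1 : ℕ) : ℝ)) / (((3 : ℕ) : ℝ) - ((1 : ℕ) : ℝ)) = 2 := by norm_num
  rw [e] at h
  exact h

/-- The width of that enclosure: `logRatioHi − logRatioLo ≤ 2^12` at scale `2^3400` (kernel check).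
[folklore] -/
theorem log_two_width : logRatioHi 1 3 3400 36 30 - logRatioLo 1 3 3400 36 30 ≤ 2 ^ 12 := by
  decide +kernel

end Literature.Analysis.SpecialFunctions.KernelLogRatio
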